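import Summits.BirchSwinnertonDyer.Rank1Residual.P2.CongruentNumberTwoOneThreeMonskyDescent
import Literature.NumberTheory.EllipticCurves.Tian2014.CMPointSystemDescentOneSevenOdd
import HarnessLib

/-!
# Cell «bsd-monsky» (prover-A, g15): ROUTE A ON `N = p₁p₇` AND `N = 2p₁p₇` WITH `(p₁/p₇) = −1` (Monsky's Thm. 5.14
# (10)/(11) / Cor. 5.15 (3); Tian's Thm. 4.4 at `k = 1`) from the cell's printed `n ≡ 3 (mod 4)` CM-point system plus
# Tian's printed divisibility sentence: rank `E_N(ℚ) = 1`, `N` congruent, `Ш[2^∞] = 0`, odd index of `y_N`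

HONEST FRAMING (cell `bsd-monsky`, run/shared/lean/pub/bsd-monsky/, README §1: ONE theorem on ONE explicit infinite
family at the prime `2`; nothing booked). This file asserts NO arithmetic fact and claims NOTHING new on paper: that `p₁p₇`
and `2p₁p₇` are congruent numbers when `(p₁/p₇) = −1` is Monsky 1990 Thm. 5.14 (10)/(11) (via Thm. 5.9) / Cor. 5.15 (3) and
Tian 2014 Thm. 4.4 at `k = 1`. It records the consequences of the transplant `Tian2014/CMPointSystemDescentOneSeven{,Odd}.lean`
— TIAN'S `β`-argument, on the SAME system `CMPointData` as the cell's enclosure — from the PRINTED BINDERS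
`hSk₁₇` (even twist) / `hSk₁₇′` (odd twist): `∀ p₀ ≡ 7, p₁ ≡ 1 (8)` primes with `(p₁/p₀) = −1`, `∃ D : CMPointData (p₀p₁)`,
`D.Printed` ∧ (`σ_{1+ϖ}` fixes `√2`) ∧ `∃ θ₂ = √2, θ₁ = √p₁ ∈ H`, `σ_{1+ϖ} θ₁ = θ₁` ∧ («`t ∈ 2𝒜` iff `σ_t` fixes `√2`, `√p₁`»,
Notations (ii)) ∧ «`[ϖ′] ∈ 2𝒜`» ∧ (`∃ t₀`, `σ_{t₀}` moves `√2`, `√p₁` — Tian's `β`) ∧ (`∃ B`, `B² = 1`, `σ_B` fixes `√2`, moves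
`√p₁` — the ambiguous class `[ϖ′_{p₁}]`, Notations (i)/(iii)) ∧ (`∀` transversals `φ`, `y_{p₀,φ} ∈ 2E(ℚ(√−p₀))⁻ + E[2]` resp.
`y_{2p₀,φ} ∈ 2E(ℚ(√−2p₀))⁻ + E[2]`) [odd twist: also «complex conjugation fixes `√2`»] — Tian 2014 Thm. 2.8, (4.8), the
Galois facts (the displays of `CMPointSystemDisplays`), g13's sentence "`σ_{1+ϖ}` moves `i` but fixes `√2`", the §4.2 /
Notations sentences, and the ONE ANALYTIC sentence of Tian's induction step, "(2) for each positive `d` with `p₀ | d | 2n`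
and `d ≠ n, 2n`, `y_d ∈ 2^k E(ℚ(√−d))⁻ + E[2]`" (p0025 L87–L94, by Thm. 3.3 = Kolyvagin + the generalised Gross–Zagier
formula + `2`-adic valuations of special `L`-values) — binder form, no new named fact; no `2`-Selmer display, no genus
display. "`#𝒜[2] = 4`" and "`#(2𝒜 ∩ 𝒜[2]) = 2`" (Tian's (1.1) at `k = 1`, the graph condition) are KERNEL THEOREMS of Gauss +
Rédei–Reichardt in the tree:
* (M-y) a transversal `φ` (Tian's `⋃_{[s]∈ψ}[s]φ₀`) and a RATIONAL point `y″ ∈ E_N(ℚ)` with `transfer y″ = y_{N,φ}` (Lemma 4.8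
  (1) / Monsky Thm. 4.7) and `y″ ∉ 2E_N(ℚ) + tor` (`Tian2014.CMPointData.exists_isReps_transfer*_seven_one_primes`);
* rank `E_N(ℚ) = 1` (`y″` non-torsion; `≤ 1` = «`S̄ = ℤ/2`» on the Cor. 5.15 families `p₁p₇`, `2p₁p₇`, the tree's exact count
  `#Sel₂ = 8`, p528474); `N` is a congruent number; `Ш[2^∞] = 0`; `y″` has ODD INDEX against every generator.
In the tree these families were reached through DOOR A {hTYZ, hGZK} resp. «`Σ₂′` odd» + DOOR B6 (g11's `Cor515Displays`);
Monsky's own proof (Thm. 5.9) needs the real-locus Lemma 5.6, off the skeleton (g10) — Tian's route reaches them with the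
analytic sentence displayed. Nothing is asserted unconditionally beyond the tree's own descent theorems.
[cite: Tian2014, Thm. 4.4 (arXiv:1210.8231 p0023 L4–L8), Lemma 4.8 (p0025 L30–L81), proof of Thm. 4.4 (p0025 L82–p0026 L51)]
[cite: Monsky1990MockHeegner, Thm. 5.9 (pp. 63–64), Thm. 5.14 (10)/(11), Cor. 5.15 (3) (p. 66), Remark (2) (p. 67)]
[cite: SilvermanAEC2009, Thm. X.4.2] [cite: TopYui2008Congruent, Prop. 3.3 (i) ⟺ (iv)]
-/

noncomputable section

open scoped Classical NumberTheorySymbols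

open WeierstrassCurve NumberField Literature.NumberTheory.EllipticCurves
  Literature.NumberTheory.EllipticCurves.Rank1Residual
  Literature.NumberTheory.EllipticCurves.Rank1Residual.Typed
  Literature.NumberTheory.EllipticCurves.Monsky1990
  Literature.NumberTheory.EllipticCurves.TianYuanZhang2017
  Literature.GroupTheory.FiniteAbelian

set_option autoImplicit false

namespace Summit.BirchSwinnertonDyer.Rank1Residual.P2

open Conjectures Literature.NumberTheory.EllipticCurves.Tian2014

/-! ## §1 The families `p₁p₇` and `2p₁p₇` with `(p₁/p₇) = −1` are Cor. 5.15 families -/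

/-- **`2p₀p₁` with `p₀ ≡ 7`, `p₁ ≡ 1 (8)` primes and `(p₁/p₀) = −1` is Monsky's family `2p₁p₇` of Cor. 5.15 (3)**.
[cite: Monsky1990MockHeegner, Cor. 5.15 (3) (p. 66)] -/
theorem isCor515Family_two_one_seven {p₀ p₁ : ℕ} (hp₀ : p₀.Prime) (hp₁ : p₁.Prime) (h₀7 : p₀ % 8 = 7)
    (h₁1 : p₁ % 8 = 1) (hj : jacobiSym (p₁ : ℤ) p₀ = -1) : IsCor515Family (2 * (p₀ * p₁)) :=
  Or.inr (Or.inr (Or.inr (Or.inr (Or.inr ⟨p₁, p₀, hp₁, hp₀, h₁1, Or.inl h₀7, hj, by rw [mul_comm p₀ p₁]⟩))))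

/-- **`p₀p₁` with `p₀ ≡ 7`, `p₁ ≡ 1 (8)` primes and `(p₁/p₀) = −1` is Monsky's family `p₁p₇` of Cor. 5.15 (3)**.
[cite: Monsky1990MockHeegner, Cor. 5.15 (3) (p. 66)] -/
theorem isCor515Family_one_seven {p₀ p₁ : ℕ} (hp₀ : p₀.Prime) (hp₁ : p₁.Prime) (h₀7 : p₀ % 8 = 7)
    (h₁1 : p₁ % 8 = 1) (hj : jacobiSym (p₁ : ℤ) p₀ = -1) : IsCor515Family (p₀ * p₁) :=
  Or.inr (Or.inr (Or.inr (Or.inr (Or.inl ⟨p₁, p₀, hp₁, hp₀, h₁1, Or.inr h₀7, hj, by rw [mul_comm p₀ p₁]⟩))))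

/-! ## §2 The EVEN twist `2p₁p₇`: the printed binder and its consequences -/

/-- **Rank `E_{2p₀p₁}(ℚ) = 1` on the family `2p₁p₇`, `(p₁/p₇) = −1`, from the printed binder** (Tian Thm. 4.4 at `k = 1`, even
twist, transplanted: `y_{2p₀p₁}` is the transfer of a rational point `y″ ∉ 2E + tor`, so `rank ≥ 1`; `rank ≤ 1` is the tree's
exact count `#Sel₂ = 8` on the Cor. 5.15 family). The analytic input is the displayed sentence `hDiv` inside the binder.
[cite: Tian2014, Thm. 4.4 (p0023 L4–L8)] [cite: Monsky1990MockHeegner, Thm. 5.14 (11), Cor. 5.15 (3) (p. 66)]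
[cite: SilvermanAEC2009, Thm. X.4.2] -/
theorem mordellWeilRank_eq_one_two_one_seven_of_printed
    (hSk₁₇ : ∀ p₀ p₁ : ℕ, (hp₀ : p₀.Prime) → (hp₁ : p₁.Prime) → p₀ % 8 = 7 → p₁ % 8 = 1 →
      jacobiSym (p₁ : ℤ) p₀ = -1 →
      ∃ D : CMPointData (p₀ * p₁), D.Printed ∧ (∀ s : D.H, s ^ 2 = 2 → D.tau s = s) ∧
        ∃ (θ₂ θ₁ : D.H) (hθ₂ : θ₂ ^ 2 = ((2 : ℕ) : D.H)) (hθ₁ : θ₁ ^ 2 = (p₁ : D.H)), D.tau θ₁ = θ₁ ∧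
          (∀ s, (D.art s θ₂ = θ₂ ∧ D.art s θ₁ = θ₁) ↔ IsSquare s) ∧ IsSquare D.piPrime ∧
          (∃ t₀ : ClassGroup (𝓞 (GenusField (2 * (p₀ * p₁)))), D.art t₀ θ₂ = -θ₂ ∧ D.art t₀ θ₁ = -θ₁) ∧
          (∃ B : ClassGroup (𝓞 (GenusField (2 * (p₀ * p₁)))), B * B = 1 ∧ D.art B θ₂ = θ₂ ∧ D.art B θ₁ = -θ₁) ∧
          ∀ φ : Finset (ClassGroup (𝓞 (GenusField (2 * (p₀ * p₁))))), D.IsRepsModPiPrime φ →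
            ∃ (w : (congruentNumberCurve p₀).toAffine.Point) (T' : EPoint D.H), (2 : ℕ) • T' = 0 ∧
              D.yPointChi (D.sqrtNegTwoN / (θ₂ * θ₁)) φ =
                transferE p₀ (D.sqrtNegTwoN / (θ₂ * θ₁)) (D.div_mul_sq_eq_neg rfl hp₁.ne_zero hθ₂ hθ₁)
                  (D.div_mul_ne_zero (Nat.mul_ne_zero hp₀.ne_zero hp₁.ne_zero) hp₁.ne_zero hθ₂ hθ₁)
                  ((2 : ℕ) • w) + T') :
    ∀ p₀ p₁ : ℕ, p₀.Prime → p₁.Prime → p₀ % 8 = 7 → p₁ % 8 = 1 → jacobiSym (p₁ : ℤ) p₀ = -1 →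
      (congruentNumberCurve (2 * (p₀ * p₁))).mordellWeilRank = 1 := by
  intro p₀ p₁ hp₀ hp₁ h₀7 h₁1 hj
  have hN : IsCor515Family (2 * (p₀ * p₁)) := isCor515Family_two_one_seven hp₀ hp₁ h₀7 h₁1 hj
  haveI := isElliptic_congruentNumberCurve hN.ne_zero
  obtain ⟨D, hP, hτ2, θ₂, θ₁, hθ₂, hθ₁, hτθ₁, hgen, hπsq, ⟨t₀, hβ2, hβ1⟩, ⟨B, hB2, hBθ₂, hBθ₁⟩, hDiv⟩ :=
    hSk₁₇ p₀ p₁ hp₀ hp₁ h₀7 h₁1 hj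
  obtain ⟨φ, -, y'', -, hnot⟩ :=
    D.exists_isReps_transfer_eq_yPoint_not_two_smul_add_torsion_seven_one_primes rfl hp₀ hp₁ h₀7 h₁1 hj hP hθ₂ hθ₁
      hτ2 hτθ₁ hgen hπsq hβ2 hβ1 hB2 hBθ₂ hBθ₁ hDiv
  exact le_antisymm (mordellWeilRank_le_one_of_isCor515Family hN)
    (Nat.one_le_iff_ne_zero.mpr (mordellWeilRank_ne_zero_of_not_two_smul_add_torsion hN.ne_zero y'' hnot))

/-- **`2p₀p₁` is a congruent number on the family `2p₁p₇`, `(p₁/p₇) = −1`, from the printed binder** (Cor. 5.15 (3)).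
[cite: Tian2014, Thm. 4.4 (p0023 L4–L8)] [cite: Monsky1990MockHeegner, Cor. 5.15 (3) (p. 66)]
[cite: TopYui2008Congruent, Prop. 3.3 (i) ⟺ (iv)] -/
theorem isCongruentNumber_two_one_seven_of_printed
    (hSk₁₇ : ∀ p₀ p₁ : ℕ, (hp₀ : p₀.Prime) → (hp₁ : p₁.Prime) → p₀ % 8 = 7 → p₁ % 8 = 1 →
      jacobiSym (p₁ : ℤ) p₀ = -1 →
      ∃ D : CMPointData (p₀ * p₁), D.Printed ∧ (∀ s : D.H, s ^ 2 = 2 → D.tau s = s) ∧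
        ∃ (θ₂ θ₁ : D.H) (hθ₂ : θ₂ ^ 2 = ((2 : ℕ) : D.H)) (hθ₁ : θ₁ ^ 2 = (p₁ : D.H)), D.tau θ₁ = θ₁ ∧
          (∀ s, (D.art s θ₂ = θ₂ ∧ D.art s θ₁ = θ₁) ↔ IsSquare s) ∧ IsSquare D.piPrime ∧
          (∃ t₀ : ClassGroup (𝓞 (GenusField (2 * (p₀ * p₁)))), D.art t₀ θ₂ = -θ₂ ∧ D.art t₀ θ₁ = -θ₁) ∧
          (∃ B : ClassGroup (𝓞 (GenusField (2 * (p₀ * p₁)))), B * B = 1 ∧ D.art B θ₂ = θ₂ ∧ D.art B θ₁ = -θ₁) ∧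
          ∀ φ : Finset (ClassGroup (𝓞 (GenusField (2 * (p₀ * p₁))))), D.IsRepsModPiPrime φ →
            ∃ (w : (congruentNumberCurve p₀).toAffine.Point) (T' : EPoint D.H), (2 : ℕ) • T' = 0 ∧
              D.yPointChi (D.sqrtNegTwoN / (θ₂ * θ₁)) φ =
                transferE p₀ (D.sqrtNegTwoN / (θ₂ * θ₁)) (D.div_mul_sq_eq_neg rfl hp₁.ne_zero hθ₂ hθ₁)
                  (D.div_mul_ne_zero (Nat.mul_ne_zero hp₀.ne_zero hp₁.ne_zero) hp₁.ne_zero hθ₂ hθ₁)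
                  ((2 : ℕ) • w) + T') :
    ∀ p₀ p₁ : ℕ, p₀.Prime → p₁.Prime → p₀ % 8 = 7 → p₁ % 8 = 1 → jacobiSym (p₁ : ℤ) p₀ = -1 →
      IsCongruentNumber (2 * (p₀ * p₁)) :=
  fun p₀ p₁ hp₀ hp₁ h₀7 h₁1 hj =>
    (Wiles2000.mordellWeilRank_ne_zero_iff_isCongruentNumber
      (by have := hp₀.pos; have := hp₁.pos; positivity)).mp
      (by rw [mordellWeilRank_eq_one_two_one_seven_of_printed hSk₁₇ p₀ p₁ hp₀ hp₁ h₀7 h₁1 hj]; exact one_ne_zero)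

/-- **`Ш(E_{2p₀p₁})[2^∞] = 0` on the family `2p₁p₇`, `(p₁/p₇) = −1`, from the printed binder** (rank one and the exact count
`#Sel₂ = 8`). [cite: Monsky1990MockHeegner, Remark (2) (p. 67)] [cite: SilvermanAEC2009, Thm. X.4.2] -/
theorem primaryComponent_sha_two_eq_bot_two_one_seven_of_printed
    (hSk₁₇ : ∀ p₀ p₁ : ℕ, (hp₀ : p₀.Prime) → (hp₁ : p₁.Prime) → p₀ % 8 = 7 → p₁ % 8 = 1 →
      jacobiSym (p₁ : ℤ) p₀ = -1 →
      ∃ D : CMPointData (p₀ * p₁), D.Printed ∧ (∀ s : D.H, s ^ 2 = 2 → D.tau s = s) ∧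
        ∃ (θ₂ θ₁ : D.H) (hθ₂ : θ₂ ^ 2 = ((2 : ℕ) : D.H)) (hθ₁ : θ₁ ^ 2 = (p₁ : D.H)), D.tau θ₁ = θ₁ ∧
          (∀ s, (D.art s θ₂ = θ₂ ∧ D.art s θ₁ = θ₁) ↔ IsSquare s) ∧ IsSquare D.piPrime ∧
          (∃ t₀ : ClassGroup (𝓞 (GenusField (2 * (p₀ * p₁)))), D.art t₀ θ₂ = -θ₂ ∧ D.art t₀ θ₁ = -θ₁) ∧
          (∃ B : ClassGroup (𝓞 (GenusField (2 * (p₀ * p₁)))), B * B = 1 ∧ D.art B θ₂ = θ₂ ∧ D.art B θ₁ = -θ₁) ∧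
          ∀ φ : Finset (ClassGroup (𝓞 (GenusField (2 * (p₀ * p₁))))), D.IsRepsModPiPrime φ →
            ∃ (w : (congruentNumberCurve p₀).toAffine.Point) (T' : EPoint D.H), (2 : ℕ) • T' = 0 ∧
              D.yPointChi (D.sqrtNegTwoN / (θ₂ * θ₁)) φ =
                transferE p₀ (D.sqrtNegTwoN / (θ₂ * θ₁)) (D.div_mul_sq_eq_neg rfl hp₁.ne_zero hθ₂ hθ₁)
                  (D.div_mul_ne_zero (Nat.mul_ne_zero hp₀.ne_zero hp₁.ne_zero) hp₁.ne_zero hθ₂ hθ₁)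
                  ((2 : ℕ) • w) + T') :
    ∀ p₀ p₁ : ℕ, (hp₀ : p₀.Prime) → (hp₁ : p₁.Prime) → p₀ % 8 = 7 → p₁ % 8 = 1 → jacobiSym (p₁ : ℤ) p₀ = -1 →
      haveI := isElliptic_congruentNumberCurve (n := 2 * (p₀ * p₁))
        (Nat.mul_ne_zero two_ne_zero (Nat.mul_ne_zero hp₀.ne_zero hp₁.ne_zero))
      AddCommGroup.primaryComponent (congruentNumberCurve (2 * (p₀ * p₁))).sha 2 = ⊥ := by
  intro p₀ p₁ hp₀ hp₁ h₀7 h₁1 hj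
  have hN : IsCor515Family (2 * (p₀ * p₁)) := isCor515Family_two_one_seven hp₀ hp₁ h₀7 h₁1 hj
  have h := (isCongruentNumber_iff_primaryComponent_sha_two_eq_bot_of_isCor515Family hN).mp
    (isCongruentNumber_two_one_seven_of_printed hSk₁₇ p₀ p₁ hp₀ hp₁ h₀7 h₁1 hj)
  convert h

/-- **TIAN'S THEOREM 4.4 AT `k = 1` (EVEN TWIST) / MONSKY'S THEOREM 5.14 (11) FOR TIAN'S POINT `y_{2p₀p₁}`, from the printed
binder**: for every such pair there are a printed system `D`, a transversal `φ` (Tian's `⋃_{[s]∈ψ}[s]φ₀`), and a rational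
point `y″ ∈ E_{2p₀p₁}(ℚ)` with `transfer y″ = y_{2p₀p₁,φ}`, of INFINITE ORDER and ODD INDEX against every generator of
`E_{2p₀p₁}(ℚ)/tor` ("`y_{2n} ∉ 2E(ℚ(√−2n))⁻ + E[2]`"). No `2`-Selmer display, no genus display, no reading mark; the one
analytic sentence is displayed as printed. [cite: Tian2014, Thm. 4.4 (p0023 L4–L8)] [cite: Monsky1990MockHeegner, Thm. 5.14 (11) (p. 66)] -/
theorem monskyOddIndex_two_one_seven_of_printed
    (hSk₁₇ : ∀ p₀ p₁ : ℕ, (hp₀ : p₀.Prime) → (hp₁ : p₁.Prime) → p₀ % 8 = 7 → p₁ % 8 = 1 →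
      jacobiSym (p₁ : ℤ) p₀ = -1 →
      ∃ D : CMPointData (p₀ * p₁), D.Printed ∧ (∀ s : D.H, s ^ 2 = 2 → D.tau s = s) ∧
        ∃ (θ₂ θ₁ : D.H) (hθ₂ : θ₂ ^ 2 = ((2 : ℕ) : D.H)) (hθ₁ : θ₁ ^ 2 = (p₁ : D.H)), D.tau θ₁ = θ₁ ∧
          (∀ s, (D.art s θ₂ = θ₂ ∧ D.art s θ₁ = θ₁) ↔ IsSquare s) ∧ IsSquare D.piPrime ∧
          (∃ t₀ : ClassGroup (𝓞 (GenusField (2 * (p₀ * p₁)))), D.art t₀ θ₂ = -θ₂ ∧ D.art t₀ θ₁ = -θ₁) ∧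
          (∃ B : ClassGroup (𝓞 (GenusField (2 * (p₀ * p₁)))), B * B = 1 ∧ D.art B θ₂ = θ₂ ∧ D.art B θ₁ = -θ₁) ∧
          ∀ φ : Finset (ClassGroup (𝓞 (GenusField (2 * (p₀ * p₁))))), D.IsRepsModPiPrime φ →
            ∃ (w : (congruentNumberCurve p₀).toAffine.Point) (T' : EPoint D.H), (2 : ℕ) • T' = 0 ∧
              D.yPointChi (D.sqrtNegTwoN / (θ₂ * θ₁)) φ =
                transferE p₀ (D.sqrtNegTwoN / (θ₂ * θ₁)) (D.div_mul_sq_eq_neg rfl hp₁.ne_zero hθ₂ hθ₁)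
                  (D.div_mul_ne_zero (Nat.mul_ne_zero hp₀.ne_zero hp₁.ne_zero) hp₁.ne_zero hθ₂ hθ₁)
                  ((2 : ℕ) • w) + T') :
    ∀ p₀ p₁ : ℕ, (hp₀ : p₀.Prime) → (hp₁ : p₁.Prime) → p₀ % 8 = 7 → p₁ % 8 = 1 → jacobiSym (p₁ : ℤ) p₀ = -1 →
      ∃ D : CMPointData (p₀ * p₁), D.Printed ∧
        ∃ φ : Finset (ClassGroup (𝓞 (GenusField (2 * (p₀ * p₁))))), D.IsRepsModPiPrime φ ∧
          ∃ y'' : (congruentNumberCurve (2 * (p₀ * p₁))).toAffine.Point,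
            D.transfer (Nat.mul_ne_zero hp₀.ne_zero hp₁.ne_zero) y'' = D.yPoint φ ∧ ¬ IsOfFinAddOrder y'' ∧
            (∀ g : (congruentNumberCurve (2 * (p₀ * p₁))).toAffine.Point, GeneratesFreePartRat (2 * (p₀ * p₁)) g →
              ∃ m : ℤ, Odd m ∧ IsOfFinAddOrder (y'' - m • g)) := by
  intro p₀ p₁ hp₀ hp₁ h₀7 h₁1 hj
  obtain ⟨D, hP, hτ2, θ₂, θ₁, hθ₂, hθ₁, hτθ₁, hgen, hπsq, ⟨t₀, hβ2, hβ1⟩, ⟨B, hB2, hBθ₂, hBθ₁⟩, hDiv⟩ :=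
    hSk₁₇ p₀ p₁ hp₀ hp₁ h₀7 h₁1 hj
  obtain ⟨φ, hφ, y'', hy'', hnot⟩ :=
    D.exists_isReps_transfer_eq_yPoint_not_two_smul_add_torsion_seven_one_primes rfl hp₀ hp₁ h₀7 h₁1 hj hP hθ₂ hθ₁
      hτ2 hτθ₁ hgen hπsq hβ2 hβ1 hB2 hBθ₂ hBθ₁ hDiv
  exact ⟨D, hP, φ, hφ, y'', hy'', not_isOfFinAddOrder_of_not_two_smul_add_torsion y'' hnot,
    fun g hg => exists_odd_isOfFinAddOrder_sub_zsmul_of_not_two_smul_add_torsion y'' hnot g hg⟩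

/-! ## §3 The ODD twist `p₁p₇`: the printed binder and its consequences -/

/-- **Rank `E_{p₀p₁}(ℚ) = 1` on the family `p₁p₇`, `(p₁/p₇) = −1`, from the printed binder** (Tian Thm. 4.4 at `k = 1`, odd
twist, transplanted: `y_{p₀p₁}` is the transfer along `√−p₀p₁` of a rational point `y″ ∉ 2E + tor`, so `rank ≥ 1`; `rank ≤ 1`
is the tree's exact count `#Sel₂ = 8` on the Cor. 5.15 family). The analytic input is the displayed sentence `hDiv` inside
the binder (on `y_{2p₀,φ}`). [cite: Tian2014, Thm. 4.4 (p0023 L4–L8)] [cite: Monsky1990MockHeegner, Thm. 5.14 (10), Cor. 5.15 (3) (p. 66)]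
[cite: SilvermanAEC2009, Thm. X.4.2] -/
theorem mordellWeilRank_eq_one_one_seven_of_printed
    (hSk₁₇' : ∀ p₀ p₁ : ℕ, (hp₀ : p₀.Prime) → (hp₁ : p₁.Prime) → p₀ % 8 = 7 → p₁ % 8 = 1 →
      jacobiSym (p₁ : ℤ) p₀ = -1 →
      ∃ D : CMPointData (p₀ * p₁), D.Printed ∧ (∀ s : D.H, s ^ 2 = 2 → D.tau s = s) ∧
        ∃ (θ₂ θ₁ : D.H) (_ : θ₂ ^ 2 = ((2 : ℕ) : D.H)) (hθ₁ : θ₁ ^ 2 = (p₁ : D.H)), D.tau θ₁ = θ₁ ∧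
          D.conj θ₂ = θ₂ ∧
          (∀ s, (D.art s θ₂ = θ₂ ∧ D.art s θ₁ = θ₁) ↔ IsSquare s) ∧ IsSquare D.piPrime ∧
          (∃ t₀ : ClassGroup (𝓞 (GenusField (2 * (p₀ * p₁)))), D.art t₀ θ₂ = -θ₂ ∧ D.art t₀ θ₁ = -θ₁) ∧
          (∃ B : ClassGroup (𝓞 (GenusField (2 * (p₀ * p₁)))), B * B = 1 ∧ D.art B θ₂ = θ₂ ∧ D.art B θ₁ = -θ₁) ∧
          ∀ φ : Finset (ClassGroup (𝓞 (GenusField (2 * (p₀ * p₁))))), D.IsRepsModPiPrime φ →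
            ∃ (w : (congruentNumberCurve (2 * p₀)).toAffine.Point) (T' : EPoint D.H), (2 : ℕ) • T' = 0 ∧
              D.yPointChi (D.sqrtNegTwoN / θ₁) φ =
                transferE (2 * p₀) (D.sqrtNegTwoN / θ₁) (D.div_sq_eq_neg rfl hp₁.ne_zero hθ₁)
                  (D.div_ne_zero' (Nat.mul_ne_zero hp₀.ne_zero hp₁.ne_zero) hp₁.ne_zero hθ₁)
                  ((2 : ℕ) • w) + T') :
    ∀ p₀ p₁ : ℕ, p₀.Prime → p₁.Prime → p₀ % 8 = 7 → p₁ % 8 = 1 → jacobiSym (p₁ : ℤ) p₀ = -1 →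
      (congruentNumberCurve (p₀ * p₁)).mordellWeilRank = 1 := by
  intro p₀ p₁ hp₀ hp₁ h₀7 h₁1 hj
  have hN : IsCor515Family (p₀ * p₁) := isCor515Family_one_seven hp₀ hp₁ h₀7 h₁1 hj
  haveI := isElliptic_congruentNumberCurve hN.ne_zero
  obtain ⟨D, hP, hτ2, θ₂, θ₁, hθ₂, hθ₁, hτθ₁, hcθ₂, hgen, hπsq, ⟨t₀, hβ2, hβ1⟩, ⟨B, hB2, hBθ₂, hBθ₁⟩, hDiv⟩ :=
    hSk₁₇' p₀ p₁ hp₀ hp₁ h₀7 h₁1 hj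
  obtain ⟨φ, -, y'', -, hnot⟩ :=
    D.exists_isReps_transferE_eq_yPointChi_not_two_smul_add_torsion_seven_one_primes rfl hp₀ hp₁ h₀7 h₁1 hj hP hθ₂
      hθ₁ hτ2 hτθ₁ hcθ₂ hgen hπsq hβ2 hβ1 hB2 hBθ₂ hBθ₁ hDiv
  exact le_antisymm (mordellWeilRank_le_one_of_isCor515Family hN)
    (Nat.one_le_iff_ne_zero.mpr (mordellWeilRank_ne_zero_of_not_two_smul_add_torsion hN.ne_zero y'' hnot))

/-- **`p₀p₁` is a congruent number on the family `p₁p₇`, `(p₁/p₇) = −1`, from the printed binder** (Cor. 5.15 (3)).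
[cite: Tian2014, Thm. 4.4 (p0023 L4–L8)] [cite: Monsky1990MockHeegner, Cor. 5.15 (3) (p. 66)]
[cite: TopYui2008Congruent, Prop. 3.3 (i) ⟺ (iv)] -/
theorem isCongruentNumber_one_seven_of_printed
    (hSk₁₇' : ∀ p₀ p₁ : ℕ, (hp₀ : p₀.Prime) → (hp₁ : p₁.Prime) → p₀ % 8 = 7 → p₁ % 8 = 1 →
      jacobiSym (p₁ : ℤ) p₀ = -1 →
      ∃ D : CMPointData (p₀ * p₁), D.Printed ∧ (∀ s : D.H, s ^ 2 = 2 → D.tau s = s) ∧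
        ∃ (θ₂ θ₁ : D.H) (_ : θ₂ ^ 2 = ((2 : ℕ) : D.H)) (hθ₁ : θ₁ ^ 2 = (p₁ : D.H)), D.tau θ₁ = θ₁ ∧
          D.conj θ₂ = θ₂ ∧
          (∀ s, (D.art s θ₂ = θ₂ ∧ D.art s θ₁ = θ₁) ↔ IsSquare s) ∧ IsSquare D.piPrime ∧
          (∃ t₀ : ClassGroup (𝓞 (GenusField (2 * (p₀ * p₁)))), D.art t₀ θ₂ = -θ₂ ∧ D.art t₀ θ₁ = -θ₁) ∧
          (∃ B : ClassGroup (𝓞 (GenusField (2 * (p₀ * p₁)))), B * B = 1 ∧ D.art B θ₂ = θ₂ ∧ D.art B θ₁ = -θ₁) ∧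
          ∀ φ : Finset (ClassGroup (𝓞 (GenusField (2 * (p₀ * p₁))))), D.IsRepsModPiPrime φ →
            ∃ (w : (congruentNumberCurve (2 * p₀)).toAffine.Point) (T' : EPoint D.H), (2 : ℕ) • T' = 0 ∧
              D.yPointChi (D.sqrtNegTwoN / θ₁) φ =
                transferE (2 * p₀) (D.sqrtNegTwoN / θ₁) (D.div_sq_eq_neg rfl hp₁.ne_zero hθ₁)
                  (D.div_ne_zero' (Nat.mul_ne_zero hp₀.ne_zero hp₁.ne_zero) hp₁.ne_zero hθ₁)
                  ((2 : ℕ) • w) + T') :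
    ∀ p₀ p₁ : ℕ, p₀.Prime → p₁.Prime → p₀ % 8 = 7 → p₁ % 8 = 1 → jacobiSym (p₁ : ℤ) p₀ = -1 →
      IsCongruentNumber (p₀ * p₁) :=
  fun p₀ p₁ hp₀ hp₁ h₀7 h₁1 hj =>
    (Wiles2000.mordellWeilRank_ne_zero_iff_isCongruentNumber
      (by have := hp₀.pos; have := hp₁.pos; positivity)).mp
      (by rw [mordellWeilRank_eq_one_one_seven_of_printed hSk₁₇' p₀ p₁ hp₀ hp₁ h₀7 h₁1 hj]; exact one_ne_zero)

/-- **`Ш(E_{p₀p₁})[2^∞] = 0` on the family `p₁p₇`, `(p₁/p₇) = −1`, from the printed binder** (rank one and the exact count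
`#Sel₂ = 8`). [cite: Monsky1990MockHeegner, Remark (2) (p. 67)] [cite: SilvermanAEC2009, Thm. X.4.2] -/
theorem primaryComponent_sha_two_eq_bot_one_seven_of_printed
    (hSk₁₇' : ∀ p₀ p₁ : ℕ, (hp₀ : p₀.Prime) → (hp₁ : p₁.Prime) → p₀ % 8 = 7 → p₁ % 8 = 1 →
      jacobiSym (p₁ : ℤ) p₀ = -1 →
      ∃ D : CMPointData (p₀ * p₁), D.Printed ∧ (∀ s : D.H, s ^ 2 = 2 → D.tau s = s) ∧
        ∃ (θ₂ θ₁ : D.H) (_ : θ₂ ^ 2 = ((2 : ℕ) : D.H)) (hθ₁ : θ₁ ^ 2 = (p₁ : D.H)), D.tau θ₁ = θ₁ ∧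
          D.conj θ₂ = θ₂ ∧
          (∀ s, (D.art s θ₂ = θ₂ ∧ D.art s θ₁ = θ₁) ↔ IsSquare s) ∧ IsSquare D.piPrime ∧
          (∃ t₀ : ClassGroup (𝓞 (GenusField (2 * (p₀ * p₁)))), D.art t₀ θ₂ = -θ₂ ∧ D.art t₀ θ₁ = -θ₁) ∧
          (∃ B : ClassGroup (𝓞 (GenusField (2 * (p₀ * p₁)))), B * B = 1 ∧ D.art B θ₂ = θ₂ ∧ D.art B θ₁ = -θ₁) ∧
          ∀ φ : Finset (ClassGroup (𝓞 (GenusField (2 * (p₀ * p₁))))), D.IsRepsModPiPrime φ →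
            ∃ (w : (congruentNumberCurve (2 * p₀)).toAffine.Point) (T' : EPoint D.H), (2 : ℕ) • T' = 0 ∧
              D.yPointChi (D.sqrtNegTwoN / θ₁) φ =
                transferE (2 * p₀) (D.sqrtNegTwoN / θ₁) (D.div_sq_eq_neg rfl hp₁.ne_zero hθ₁)
                  (D.div_ne_zero' (Nat.mul_ne_zero hp₀.ne_zero hp₁.ne_zero) hp₁.ne_zero hθ₁)
                  ((2 : ℕ) • w) + T') :
    ∀ p₀ p₁ : ℕ, (hp₀ : p₀.Prime) → (hp₁ : p₁.Prime) → p₀ % 8 = 7 → p₁ % 8 = 1 → jacobiSym (p₁ : ℤ) p₀ = -1 →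
      haveI := isElliptic_congruentNumberCurve (n := p₀ * p₁) (Nat.mul_ne_zero hp₀.ne_zero hp₁.ne_zero)
      AddCommGroup.primaryComponent (congruentNumberCurve (p₀ * p₁)).sha 2 = ⊥ := by
  intro p₀ p₁ hp₀ hp₁ h₀7 h₁1 hj
  have hN : IsCor515Family (p₀ * p₁) := isCor515Family_one_seven hp₀ hp₁ h₀7 h₁1 hj
  have h := (isCongruentNumber_iff_primaryComponent_sha_two_eq_bot_of_isCor515Family hN).mp
    (isCongruentNumber_one_seven_of_printed hSk₁₇' p₀ p₁ hp₀ hp₁ h₀7 h₁1 hj)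
  convert h

/-- **TIAN'S THEOREM 4.4 AT `k = 1` (ODD TWIST) / MONSKY'S THEOREM 5.14 (10) FOR TIAN'S POINT `y_{p₀p₁}`, from the printed
binder**: for every such pair there are a printed system `D`, a transversal `φ`, and a rational point `y″ ∈ E_{p₀p₁}(ℚ)` with
`transfer_{√−p₀p₁} y″ = y_{p₀p₁,φ}` (the signed sum with `χ_{p₀p₁}`), of INFINITE ORDER and ODD INDEX against every generator
of `E_{p₀p₁}(ℚ)/tor` ("`y_n ∉ 2E(ℚ(√−n))⁻ + E[2]`"). No `2`-Selmer display, no genus display, no reading mark; the one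
analytic sentence is displayed as printed. [cite: Tian2014, Thm. 4.4 (p0023 L4–L8)] [cite: Monsky1990MockHeegner, Thm. 5.14 (10) (p. 66)] -/
theorem monskyOddIndex_one_seven_of_printed
    (hSk₁₇' : ∀ p₀ p₁ : ℕ, (hp₀ : p₀.Prime) → (hp₁ : p₁.Prime) → p₀ % 8 = 7 → p₁ % 8 = 1 →
      jacobiSym (p₁ : ℤ) p₀ = -1 →
      ∃ D : CMPointData (p₀ * p₁), D.Printed ∧ (∀ s : D.H, s ^ 2 = 2 → D.tau s = s) ∧
        ∃ (θ₂ θ₁ : D.H) (_ : θ₂ ^ 2 = ((2 : ℕ) : D.H)) (hθ₁ : θ₁ ^ 2 = (p₁ : D.H)), D.tau θ₁ = θ₁ ∧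
          D.conj θ₂ = θ₂ ∧
          (∀ s, (D.art s θ₂ = θ₂ ∧ D.art s θ₁ = θ₁) ↔ IsSquare s) ∧ IsSquare D.piPrime ∧
          (∃ t₀ : ClassGroup (𝓞 (GenusField (2 * (p₀ * p₁)))), D.art t₀ θ₂ = -θ₂ ∧ D.art t₀ θ₁ = -θ₁) ∧
          (∃ B : ClassGroup (𝓞 (GenusField (2 * (p₀ * p₁)))), B * B = 1 ∧ D.art B θ₂ = θ₂ ∧ D.art B θ₁ = -θ₁) ∧
          ∀ φ : Finset (ClassGroup (𝓞 (GenusField (2 * (p₀ * p₁))))), D.IsRepsModPiPrime φ →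
            ∃ (w : (congruentNumberCurve (2 * p₀)).toAffine.Point) (T' : EPoint D.H), (2 : ℕ) • T' = 0 ∧
              D.yPointChi (D.sqrtNegTwoN / θ₁) φ =
                transferE (2 * p₀) (D.sqrtNegTwoN / θ₁) (D.div_sq_eq_neg rfl hp₁.ne_zero hθ₁)
                  (D.div_ne_zero' (Nat.mul_ne_zero hp₀.ne_zero hp₁.ne_zero) hp₁.ne_zero hθ₁)
                  ((2 : ℕ) • w) + T') :
    ∀ p₀ p₁ : ℕ, (hp₀ : p₀.Prime) → (hp₁ : p₁.Prime) → p₀ % 8 = 7 → p₁ % 8 = 1 → jacobiSym (p₁ : ℤ) p₀ = -1 →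
      ∃ D : CMPointData (p₀ * p₁), D.Printed ∧
        ∃ (θ₂ : D.H) (hθ₂ : θ₂ ^ 2 = ((2 : ℕ) : D.H)),
          ∃ φ : Finset (ClassGroup (𝓞 (GenusField (2 * (p₀ * p₁))))), D.IsRepsModPiPrime φ ∧
            ∃ y'' : (congruentNumberCurve (p₀ * p₁)).toAffine.Point,
              transferE (p₀ * p₁) (D.sqrtNegTwoN / θ₂) (D.div_two_sq_eq_neg hθ₂)
                  (D.div_two_ne_zero (Nat.mul_ne_zero hp₀.ne_zero hp₁.ne_zero) hθ₂) y'' =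
                D.yPointChi (D.sqrtNegTwoN / θ₂) φ ∧ ¬ IsOfFinAddOrder y'' ∧
              (∀ g : (congruentNumberCurve (p₀ * p₁)).toAffine.Point, GeneratesFreePartRat (p₀ * p₁) g →
                ∃ m : ℤ, Odd m ∧ IsOfFinAddOrder (y'' - m • g)) := by
  intro p₀ p₁ hp₀ hp₁ h₀7 h₁1 hj
  obtain ⟨D, hP, hτ2, θ₂, θ₁, hθ₂, hθ₁, hτθ₁, hcθ₂, hgen, hπsq, ⟨t₀, hβ2, hβ1⟩, ⟨B, hB2, hBθ₂, hBθ₁⟩, hDiv⟩ :=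
    hSk₁₇' p₀ p₁ hp₀ hp₁ h₀7 h₁1 hj
  obtain ⟨φ, hφ, y'', hy'', hnot⟩ :=
    D.exists_isReps_transferE_eq_yPointChi_not_two_smul_add_torsion_seven_one_primes rfl hp₀ hp₁ h₀7 h₁1 hj hP hθ₂
      hθ₁ hτ2 hτθ₁ hcθ₂ hgen hπsq hβ2 hβ1 hB2 hBθ₂ hBθ₁ hDiv
  exact ⟨D, hP, θ₂, hθ₂, φ, hφ, y'', hy'', not_isOfFinAddOrder_of_not_two_smul_add_torsion y'' hnot,
    fun g hg => exists_odd_isOfFinAddOrder_sub_zsmul_of_not_two_smul_add_torsion y'' hnot g hg⟩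

/-! ## §4 Monsky's Cor. 5.15 (3) COMPLETE for Tian's points: `p₁p₅`, `p₁p₇`, `2p₁p₃`, `2p₁p₇` with `(p₁/p) = −1` -/

/-- **Monsky's Cor. 5.15 (3) — «`p₁p₅`, `p₁p₇`, `2p₁p₃`, `2p₁p₇` are congruent numbers when `(p₁/p) = −1`» — COMPLETE for Tian's
points, rank one and congruent on all four families, from the four printed binders alone** (this supersedes the census sentence
"all of (3) … none of these is on the skeleton" of g14's `cor515_routeA_of_printed`): `hSk₁₅` (Tian Thm. 4.1 at `k = 1` on the `n ≡ 1 (4)` system, g14), `hSk₁₃` (Thm. 4.5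
at `k = 1`, g14), `hSk₁₇` / `hSk₁₇'` (Thm. 4.4 at `k = 1`, both twists, this file). Each binder is Tian's printed skeleton, the §4.1/§4.2
Galois sentences, and the one analytic sentence "`y_d ∈ 2^k E(ℚ(√±d))⁻ + E[2]`" (Thm. 3.3) — the first step of BOTH of Tian's
inductions, by Tian's route, no Gross–Zagier input on the curve itself.
[cite: Monsky1990MockHeegner, Cor. 5.15 (3) (p. 66)] [cite: Tian2014, Thm. 4.1 (p0019 L65–L70), Thm. 4.4, Thm. 4.5 (p0023 L4–L14)] -/
theorem cor515_three_of_printed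
    (hSk₁₅ : ∀ p₀ p₁ : ℕ, (hp₀ : p₀.Prime) → p₁.Prime → p₀ % 8 = 5 → p₁ % 8 = 1 → jacobiSym (p₁ : ℤ) p₀ = -1 →
      ∃ D : CMPointDataOne (p₀ * p₁), D.Printed ∧
        ∃ (θ₀ : D.H) (hθ₀ : θ₀ ^ 2 = (p₀ : D.H)) (θ₁ : D.H), θ₁ ^ 2 = (p₁ : D.H) ∧
          D.conj θ₀ = θ₀ ∧ D.conj θ₁ = θ₁ ∧ (∀ s, (D.art s θ₀ = θ₀ ∧ D.art s θ₁ = θ₁) ↔ IsSquare s) ∧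
          D.art D.piClass θ₀ = -θ₀ ∧ D.art D.piClass θ₁ = θ₁ ∧ (∀ x : D.H, x ^ 2 ≠ -1) ∧
          ∃ (w : (congruentNumberCurve p₀).toAffine.Point) (T' : EPoint D.H), (2 : ℕ) • T' = 0 ∧
            D.yTrace θ₀ = D.transferAlong p₀ hp₀.ne_zero hθ₀ ((2 : ℕ) • w) + T')
    (hSk₁₃ : ∀ p₀ p₁ : ℕ, (hp₀ : p₀.Prime) → (hp₁ : p₁.Prime) → p₀ % 8 = 3 → p₁ % 8 = 1 →
      jacobiSym (p₁ : ℤ) p₀ = -1 →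
      ∃ D : CMPointData (p₀ * p₁), D.Printed ∧ (∀ s : D.H, s ^ 2 = 2 → D.tau s = s) ∧
        ∃ (θ₁ : D.H) (hθ₁ : θ₁ ^ 2 = (p₁ : D.H)), D.tau θ₁ = θ₁ ∧
          ∃ B : ClassGroup (𝓞 (GenusField (2 * (p₀ * p₁)))), B * B = 1 ∧ B ≠ 1 ∧ B ≠ D.piPrime ∧
            D.art B θ₁ = -θ₁ ∧
            ∀ φ : Finset (ClassGroup (𝓞 (GenusField (2 * (p₀ * p₁))))), D.IsRepsModPiPrime φ →
              IsStableUnder B φ →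
              ∃ (w : (congruentNumberCurve (2 * p₀)).toAffine.Point) (T' : EPoint D.H), (2 : ℕ) • T' = 0 ∧
                D.yPointChi (D.sqrtNegTwoN / θ₁) φ =
                  transferE (2 * p₀) (D.sqrtNegTwoN / θ₁) (D.div_sq_eq_neg rfl hp₁.ne_zero hθ₁)
                    (D.div_ne_zero' (Nat.mul_ne_zero hp₀.ne_zero hp₁.ne_zero) hp₁.ne_zero hθ₁)
                    ((2 : ℕ) • w) + T')
    (hSk₁₇ : ∀ p₀ p₁ : ℕ, (hp₀ : p₀.Prime) → (hp₁ : p₁.Prime) → p₀ % 8 = 7 → p₁ % 8 = 1 →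
      jacobiSym (p₁ : ℤ) p₀ = -1 →
      ∃ D : CMPointData (p₀ * p₁), D.Printed ∧ (∀ s : D.H, s ^ 2 = 2 → D.tau s = s) ∧
        ∃ (θ₂ θ₁ : D.H) (hθ₂ : θ₂ ^ 2 = ((2 : ℕ) : D.H)) (hθ₁ : θ₁ ^ 2 = (p₁ : D.H)), D.tau θ₁ = θ₁ ∧
          (∀ s, (D.art s θ₂ = θ₂ ∧ D.art s θ₁ = θ₁) ↔ IsSquare s) ∧ IsSquare D.piPrime ∧
          (∃ t₀ : ClassGroup (𝓞 (GenusField (2 * (p₀ * p₁)))), D.art t₀ θ₂ = -θ₂ ∧ D.art t₀ θ₁ = -θ₁) ∧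
          (∃ B : ClassGroup (𝓞 (GenusField (2 * (p₀ * p₁)))), B * B = 1 ∧ D.art B θ₂ = θ₂ ∧ D.art B θ₁ = -θ₁) ∧
          ∀ φ : Finset (ClassGroup (𝓞 (GenusField (2 * (p₀ * p₁))))), D.IsRepsModPiPrime φ →
            ∃ (w : (congruentNumberCurve p₀).toAffine.Point) (T' : EPoint D.H), (2 : ℕ) • T' = 0 ∧
              D.yPointChi (D.sqrtNegTwoN / (θ₂ * θ₁)) φ =
                transferE p₀ (D.sqrtNegTwoN / (θ₂ * θ₁)) (D.div_mul_sq_eq_neg rfl hp₁.ne_zero hθ₂ hθ₁)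
                  (D.div_mul_ne_zero (Nat.mul_ne_zero hp₀.ne_zero hp₁.ne_zero) hp₁.ne_zero hθ₂ hθ₁)
                  ((2 : ℕ) • w) + T')
    (hSk₁₇' : ∀ p₀ p₁ : ℕ, (hp₀ : p₀.Prime) → (hp₁ : p₁.Prime) → p₀ % 8 = 7 → p₁ % 8 = 1 →
      jacobiSym (p₁ : ℤ) p₀ = -1 →
      ∃ D : CMPointData (p₀ * p₁), D.Printed ∧ (∀ s : D.H, s ^ 2 = 2 → D.tau s = s) ∧
        ∃ (θ₂ θ₁ : D.H) (_ : θ₂ ^ 2 = ((2 : ℕ) : D.H)) (hθ₁ : θ₁ ^ 2 = (p₁ : D.H)), D.tau θ₁ = θ₁ ∧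
          D.conj θ₂ = θ₂ ∧
          (∀ s, (D.art s θ₂ = θ₂ ∧ D.art s θ₁ = θ₁) ↔ IsSquare s) ∧ IsSquare D.piPrime ∧
          (∃ t₀ : ClassGroup (𝓞 (GenusField (2 * (p₀ * p₁)))), D.art t₀ θ₂ = -θ₂ ∧ D.art t₀ θ₁ = -θ₁) ∧
          (∃ B : ClassGroup (𝓞 (GenusField (2 * (p₀ * p₁)))), B * B = 1 ∧ D.art B θ₂ = θ₂ ∧ D.art B θ₁ = -θ₁) ∧
          ∀ φ : Finset (ClassGroup (𝓞 (GenusField (2 * (p₀ * p₁))))), D.IsRepsModPiPrime φ →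
            ∃ (w : (congruentNumberCurve (2 * p₀)).toAffine.Point) (T' : EPoint D.H), (2 : ℕ) • T' = 0 ∧
              D.yPointChi (D.sqrtNegTwoN / θ₁) φ =
                transferE (2 * p₀) (D.sqrtNegTwoN / θ₁) (D.div_sq_eq_neg rfl hp₁.ne_zero hθ₁)
                  (D.div_ne_zero' (Nat.mul_ne_zero hp₀.ne_zero hp₁.ne_zero) hp₁.ne_zero hθ₁)
                  ((2 : ℕ) • w) + T') :
    ∀ p₀ p₁ : ℕ, p₀.Prime → p₁.Prime → p₁ % 8 = 1 → jacobiSym (p₁ : ℤ) p₀ = -1 →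
      (p₀ % 8 = 5 → (congruentNumberCurve (p₀ * p₁)).mordellWeilRank = 1 ∧ IsCongruentNumber (p₀ * p₁)) ∧
      (p₀ % 8 = 7 → (congruentNumberCurve (p₀ * p₁)).mordellWeilRank = 1 ∧ IsCongruentNumber (p₀ * p₁)) ∧
      (p₀ % 8 = 3 → (congruentNumberCurve (2 * (p₀ * p₁))).mordellWeilRank = 1 ∧ IsCongruentNumber (2 * (p₀ * p₁))) ∧
      (p₀ % 8 = 7 → (congruentNumberCurve (2 * (p₀ * p₁))).mordellWeilRank = 1 ∧ IsCongruentNumber (2 * (p₀ * p₁))) :=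
  fun p₀ p₁ hp₀ hp₁ h₁1 hj =>
    ⟨fun h₀5 => ⟨mordellWeilRank_eq_one_one_five_of_printed hSk₁₅ p₀ p₁ hp₀ hp₁ h₀5 h₁1 hj,
        isCongruentNumber_one_five_of_printed hSk₁₅ p₀ p₁ hp₀ hp₁ h₀5 h₁1 hj⟩,
     fun h₀7 => ⟨mordellWeilRank_eq_one_one_seven_of_printed hSk₁₇' p₀ p₁ hp₀ hp₁ h₀7 h₁1 hj,
        isCongruentNumber_one_seven_of_printed hSk₁₇' p₀ p₁ hp₀ hp₁ h₀7 h₁1 hj⟩,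
     fun h₀3 => ⟨mordellWeilRank_eq_one_two_one_three_of_printed hSk₁₃ p₀ p₁ hp₀ hp₁ h₀3 h₁1 hj,
        isCongruentNumber_two_one_three_of_printed hSk₁₃ p₀ p₁ hp₀ hp₁ h₀3 h₁1 hj⟩,
     fun h₀7 => ⟨mordellWeilRank_eq_one_two_one_seven_of_printed hSk₁₇ p₀ p₁ hp₀ hp₁ h₀7 h₁1 hj,
        isCongruentNumber_two_one_seven_of_printed hSk₁₇ p₀ p₁ hp₀ hp₁ h₀7 h₁1 hj⟩⟩

end Summit.BirchSwinnertonDyer.Rank1Residual.P2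

end
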